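import Summits.BirchSwinnertonDyer.BirchSwinnertonDyer.Theorems.ClassRecordThreeShimuraKolyvaginCebotarevOfImage
import HarnessLib

/-!
# McCallum's Cor. 3.2 at ANY odd `p` for every irreducible `E[p]` whose image over `ℚ` contains
# `−1`, under Gross's `(d_K, p N_E) = 1` (cell `bsd-stepL`, seat `bsd-stepL-shim3b` g4; helper for
# the record item stmt-BirchSwinnertonDyer-19616 `ShimuraKolyvaginOrderBoundAtThree`; of use to the
# `p ≥ 5` ¬Surj corners as well)

HONEST FRAMING (programme file §HONESTY, verbatim): «no tranche here proves BSD; ARM L moves the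
LITERAL column of an r ≤ 1 census into the kernel-proved-modulo-named-print column; ARM P changes what
«named print» is worth. The residue (4.31 %) and every SUMMIT-BEARING rung (S0–S3) stay theorem-bound
and are staffed by the 22 routes, not by this programme.» THEOREMS ONLY (no definition, no named fact,
no `sorry`); nothing here is a BSD class theorem; no census label moves; item 19616 stays ASIDE.

## What this file does

`ShimuraKolyvaginCebotarevOfImage.McCallum1991_cor_3_2_pow_three_of_irr` is specific to `p = 3`
only through its `−1`-input: every irreducible subgroup of `GL₂(𝔽₃)` contains `−1` (seat g3,
`ShimuraKolyvaginMinusOneSquare`).  For a general odd `p` an irreducible image need NOT contain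
`−1` (e.g. `p = 7`, the dihedral group of order `6` generated by `diag(2,4)` and the flip), and then
Kolyvagin's argument changes (the error terms of Matar–Nekovář 2019, §5).  This file isolates the
clean case:

* `exists_smul_eq_neg_baseChange_of_exists` — under Gross's disjointness hypothesis (a prime
  `q ∣ d_K`, `q ∤ n N_E`, `[K:ℚ] = 2`), if some `γ ∈ Γ_ℚ` acts as `−1` on `E(ℚ̄)[n]` then some
  `g ∈ Γ_K` acts as `−1` on `E(K̄)[n]` (`ShimuraKolyvaginImageDisjoint.exists_smul_torsionEquiv_eq`).
* **`McCallum1991_cor_3_2_pow_of_irr_of_neg`** — for ANY odd prime `p`, `E/ℚ` with `E[p]`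
  irreducible and `−1 ∈ ρ̄_{E,p}(Γ_ℚ)`, `K` imaginary quadratic and a prime `q ∣ d_K` with
  `q ∤ p N_E`: McCallum's Cor. 3.2 at every level `p^M`, UNCONDITIONALLY (inputs: §3–§5 of the two
  prequels; Čebotarev and the Weil pairing are tree theorems).  Covers every surjective image,
  every image containing `SL₂(𝔽_p)`, the normaliser-of-Cartan images containing `−1`, and at
  `p = 3` everything (`McCallum1991_cor_3_2_pow_three_of_irr`).

NOT claimed: Kolyvagin classes, Euler-system relations, any order bound; images without `−1`.

References: [McCallumLMS1991] §3 Cor. 3.2; [GrossLMS1991] §9; [MatarNekovar2019] §5 (Prop. 5.26);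
[Cha2005] Lemmas 22–23; [Serre1972] §2.
-/

set_option autoImplicit false
set_option linter.dupNamespace false -- the Theorems namespace repeats the summit name, as in every sibling

noncomputable section

open scoped Classical Pointwise

open WeierstrassCurve NumberField IsDedekindDomain Field Literature.NumberTheory
  Literature.NumberTheory.EllipticCurves Literature.NumberTheory.GaloisRepresentations
  Summit.BirchSwinnertonDyer.BirchSwinnertonDyer.Theorems.ShimuraKolyvaginImageDisjoint
  Summit.BirchSwinnertonDyer.BirchSwinnertonDyer.Theorems.ShimuraKolyvaginImageInputs
  Summit.BirchSwinnertonDyer.BirchSwinnertonDyer.Theorems.ShimuraKolyvaginCebotarevOfImage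

universe u

namespace Summit.BirchSwinnertonDyer.BirchSwinnertonDyer.Theorems.ShimuraKolyvaginCebotarevOfImageOdd

variable (W : WeierstrassCurve ℚ) [W.IsElliptic] (K : Type u) [Field K] [NumberField K]

/-- **`−1 ∈ ρ̄_{E,n}(Γ_ℚ) ⟹ −1 ∈ ρ̄_{E,n}(Γ_K)` under Gross's disjointness** (`[K:ℚ] = 2`, a prime
`q ∣ d_K` with `q ∤ n N_E`): the element of `Γ_ℚ` acting as `−1` on `E(ℚ̄)[n]` acts through some
`g ∈ Γ_K` (`exists_smul_torsionEquiv_eq`), and the transport `θ : E(ℚ̄)[n] ≃ E(K̄)[n]` is additive.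
[cite: GrossLMS1991, §9 (PDF p. 227, before Prop. 9.1)] -/
theorem exists_smul_eq_neg_baseChange_of_exists (hK : Module.finrank ℚ K = 2) {q : ℕ}
    (hq : q.Prime) (hqd : (q : ℤ) ∣ NumberField.discr K) (hqN : ¬ q ∣ W.conductorNorm ℤ)
    {n : ℤ} (hqn : ¬ (q : ℤ) ∣ n)
    (hneg : ∃ γ : absoluteGaloisGroup ℚ, ∀ P : geomTorsion W n, γ • P = -P) :
    ∃ g : absoluteGaloisGroup K, ∀ Q : geomTorsion (W.baseChange K) n, g • Q = -Q := by
  obtain ⟨γ, hγ⟩ := hneg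
  obtain ⟨g, hg⟩ := exists_smul_torsionEquiv_eq W K hK hq hqd hqN hqn γ
  refine ⟨g, fun Q ↦ ?_⟩
  obtain ⟨P, rfl⟩ := (RatClosure.torsionEquiv (K := K) W n).surjective Q
  rw [hg, hγ, map_neg]

/-- **McCallum's Cor. 3.2 at ANY odd prime `p`, every level `p^M`, for every `E/ℚ` with `E[p]`
irreducible and `−1 ∈ ρ̄_{E,p}(Γ_ℚ)`**, `K` imaginary quadratic and a prime `q ∣ d_K` with
`q ∤ p N_E` (Gross's «`D` prime to `Np`», here only at one prime): given the complex conjugation `c`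
of `K`, non-zero `c`-eigenclasses `c_i ∈ H¹(K, E[p^M])` with McCallum's independence and exponents
`N_i` (`p^{N_i - 1} c_i ≠ 0`), above every bound there is a Kolyvagin prime `ℓ`
(`IsKolyvaginPrime N W K p ℓ`) with `Frob(ℓ) = Frob(∞)` in `Gal(K(E_{p^M})/ℚ)` and
`ord c_{i,λ} = p^{N_i}` at `λ ∋ ℓ`.  UNCONDITIONAL: `hz` from `exists_smul_eq_neg_baseChange_of_exists`,
`hS` ∕ `hC` from `ShimuraKolyvaginImageInputs` (§4–§5), Weil pairing `exists_weilPairing_holds`,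
Čebotarev `Automorphic.chebotarev_artinRep_of_galoisSide`.  The hypothesis `−1 ∈ ρ̄(Γ_ℚ)` holds for
every image containing `SL₂(𝔽_p)` and for every irreducible image at `p = 3`; without it the
argument acquires the error terms of Matar–Nekovář 2019 §5 (not treated).
[cite: McCallumLMS1991, §3 Cor. 3.2] [cite: MatarNekovar2019, Prop. 5.26 (2)]
[cite: Cha2005, Lemmas 22–23] -/
theorem McCallum1991_cor_3_2_pow_of_irr_of_neg {N : ℕ} [NeZero N] (hN : W.conductorNorm ℤ = N)
    {p : ℕ} (hp : p.Prime) (hp2 : p ≠ 2) (hirr : W.HasIrreducibleModPGaloisRep p)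
    (hneg : ∃ γ : absoluteGaloisGroup ℚ, ∀ P : geomTorsion W p, γ • P = -P)
    (hK : IsImaginaryQuadratic K) {q : ℕ} (hq : q.Prime) (hqd : (q : ℤ) ∣ NumberField.discr K)
    (hqN : ¬ q ∣ N) (hqp : q ≠ p) {M : ℕ} (hM : 1 ≤ M)
    {c : K ≃ₐ[ℚ] K} (hc : c ≠ 1) {r : ℕ}
    (cs : Fin r → galH1Torsion (W.baseChange K) ((p ^ M : ℕ) : ℤ)) (h0 : ∀ i, cs i ≠ 0)
    (Nv : Fin r → ℕ) (hNv : ∀ i, Nv i ≠ 0 → ((p : ℤ) ^ (Nv i - 1)) • cs i ≠ 0)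
    (hτ : ∀ i, ∃ e : ℤ, (e = 1 ∨ e = -1) ∧ conjAct W c ((p ^ M : ℕ) : ℤ) (cs i) = e • cs i)
    (hind : ∀ a : Fin r → ℤ, ∑ i, a i • cs i = 0 → ∀ i, a i • cs i = 0) (b : ℕ) :
    ∃ ℓ : ℕ, b < ℓ ∧ IsKolyvaginPrime N W K p ℓ ∧ FrobEqFrobInfty W K (p ^ M) ℓ ∧
      ∀ i, ∀ v : HeightOneSpectrum (𝓞 K), (ℓ : 𝓞 K) ∈ v.asIdeal →
        (((p : ℤ) ^ Nv i) • cs i ∈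
            (W.baseChange K).torsionLocalKer (v.adicCompletion K) ((p ^ M : ℕ) : ℤ) ∧
          (Nv i ≠ 0 → ((p : ℤ) ^ (Nv i - 1)) • cs i ∉
            (W.baseChange K).torsionLocalKer (v.adicCompletion K) ((p ^ M : ℕ) : ℤ))) := by
  haveI : Fact p.Prime := ⟨hp⟩
  have hqN' : ¬ q ∣ W.conductorNorm ℤ := by rwa [hN]
  have hqp' : ¬ (q : ℤ) ∣ (p : ℤ) := fun h ↦ hqp
    ((Nat.prime_dvd_prime_iff_eq hq hp).mp (by exact_mod_cast h))
  have hz : ∃ z : absoluteGaloisGroup K, ∀ t : geomTorsion (W.baseChange K) p, z • t = -t :=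
    exists_smul_eq_neg_baseChange_of_exists W K hK.1 hq hqd hqN' hqp' hneg
  have hS : (W.baseChange K).HasIrreducibleModPGaloisRep p :=
    hasIrreducibleModPGaloisRep_baseChange W K hK.1 hq hqd hqN' hqp' hirr
  exact McCallum1991_cor_3_2_pow_of_image (W := W) Automorphic.chebotarev_artinRep_of_galoisSide
    hK hp hp2 hz hS
    (fun f hf ↦ exists_eq_zsmul_baseChange_of_irr W K hK.1 hq hqd hqN' hp2 hqp' hirr f hf)
    (W.exists_weilPairing_holds p) hM hc cs h0 Nv hNv hτ hind b

end Summit.BirchSwinnertonDyer.BirchSwinnertonDyer.Theorems.ShimuraKolyvaginCebotarevOfImageOdd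

end
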